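import Summits.QuantumFields.YangMills.Theorems.FluctuationComparisonRegPrIntLS2BetaStaircaseSlotStokes
import Summits.QuantumFields.YangMills.Theorems.FluctuationComparisonRegPrIntLS2BetaIterAxialGaugeOneLevel
import HarnessLib

/-!
# S2β · `hFlat` road, brick (ii-b)₂ of UV3-NODE §57.8 (D) — THE RELATIVE COMB-AXIAL LETTERS IN SUM CURRENCY (interior bonds, face bonds, the spine quotient)

Cell `ym3-torus` (rung R3 = continuum `SU(2)` Yang–Mills on the three-torus — NOT d = 4, NOT infinite volume, NOT a mass gap, NOT Clay).
Width seat «width 13» `ym3-torus-px13` (gen 22), FREE px helper on crux `stmt-QuantumFields-20520` (`Theses.UnitScaleTilt.FluctuationComparisonRegPrIntL`),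
count-neutral, DEFINITION-FREE, any gauge group `[GaugeGroup G]`, any height `j` of the `Setup` tower (the block corollaries in the standing range `j + 1 ≤ m + K`).

WHY (UV3-NODE §57.8 (B) (R2), px8 g21; px12 g22 note v4 §7).  In the recursion `B_t ≤ √L·B_{t+1} + R_t` the error `R_t` is the ℓ² size of the relative field
`rel = W·U₀⁻¹` of the level-`t` configuration `W` in the comb axial gauge RELATIVE TO THE BACKGROUND `U₀` (= the lift of the coarser field; tree gauge
✓`Prop7AxialGauge.exists_axialGauge`).  The letters, bond class by bond class, with the right side a SUM over a `W, U₀`-independent local plaquette-slot family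
(companion ✓`…S2BetaStaircaseSlotStokes`) — the tree's sup editions are ✓`Prop7AxialGaugeSup.dist1_mul_inv_le_of_axial` ∕ ✓`Prop7AxialGaugeBlock` ∕ ✓`…Face`:
* COMB (tree) bonds: `rel = 1` EXACTLY (the slot sets of §1 are empty on the comb).
* §1 ★★ `exists_sites_dist1_mul_inv_le_of_axial` — NON-TREE INTERIOR bonds: `dist1(W_b·U₀,b⁻¹) ≤ Σ_{κ≠μ} Σ_{r<|(x−y)_κ|} (dist1 W(∂p) + dist1 U₀(∂p))`, at most
  `|x−y|₁` slots in the box of the comb (algebra ✓`mul_inv_eq_conj_of_axial`; fundamental cycle = comb fan); ★★ `exists_sites_dist1_mul_inv_le_interior` — the same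
  at a block of the averaging tower (no wrap by ✓`noWrap_emb`, slots inside the block by ✓`natAbs_rel_emb_le`, px10 (i)).
* §2 ★ `dist1_faceLoop_le_fan_add_stair` — the closed face word `Γ_{y,x} ∪ [x,x+e_μ] ∪ (−Γ_{y′,x+e_μ}) ∪ (−spine)` splits as conj(fan at the end of the
  `μ`-segment, row `1`) · (diagonal staircase over the earlier axes, row `N`): the `μ`-segments `p, 1, q` concatenate to the transported spine;
  ★★ `exists_sites_faceLoop_le` — its sum-currency bound, `(N+1)·|v|₁`-many slots («a sum of `O(L²)` plaquette holonomies», (R2));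
  ★★ `exists_sites_dist1_mul_inv_le_face_of_axial` — FACE bonds: `dist1(W_b·U₀,b⁻¹) ≤ Σ_slots (dist1 W(∂p) + dist1 U₀(∂p)) + dist1 (W(spine)·U₀(spine)⁻¹)`
  (algebra ✓`holAt_faceWord_of_axial` + ✓`dist1_mul_inv_le_three`): the coarse transporters enter ONLY through the SPINE QUOTIENT — «the coarse bond
  CANCELS, no `B_{t+1}` contamination in `R_t`»; `dist1_axialAvg_mul_inv_eq_corr` — the quotient is `dist1 (corr ℰ W c)` once the background reproduces the
  (0.4) average along the spine (✓(b3) §6); ★★★ `exists_sites_dist1_mul_inv_le_face` — the same at a block face of the tower (`N = L`, face geometry by name: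
  ✓`rel_emb_face`, ✓`rel_emb_shift_of_face`, px10 (i) ✓p814311).
The ARC-currency bond split and the finite Minkowski step that turn these letters into `B_t ≤ √L·B_{t+1} + R_t` are the companion `…S2BetaArcBondSplit`.

HONEST SCOPE.  Kinematic bookkeeping over landed tree lemmas; the slot multiplicities (the one-level count turning Σ_b (Σ_slots)² into `C(L)·Σ_p`) are NOT
counted here; nothing of Bałaban's analysis ([Balaban1985RegularSpaces] Lemma 1 (1.25)–(1.26) is the printed sup statement); the lift `U₀` is NOT constructed
(abstract background); `hFlat`, TUBE-REG∘, GAP♯∘, S2β, crux 20520, `YM3TorusSU2` NOT proved; no registered stub is closed; the Yang–Mills mass gap is NOT proved.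
References: T. Bałaban, CMP **99** (1985) 75–102 [Balaban1985RegularSpaces] ((1.19) p.79, Lemma 1 (1.24)–(1.26) pp.79–80, (1.29) p.81); CMP **98** (1985) 17–51
[Balaban1985Averaging] ((9)–(10) p.19, (19)–(20) p.21, pp.24–25); CMP **109** (1987) 249–301 [Balaban1987RG1] ((0.3)–(0.4) pp.252–253).
-/

set_option autoImplicit false

namespace Summit.QuantumFields.YangMills.Theorems.FluctuationComparisonRegPrIntLS2BetaRelativeFieldLetter

open Finset
open Literature.MathematicalPhysics.QuantumFieldTheory.Balaban1983to89
open T4Continuum T4ReflectionCone BlockAveraging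
open B10Eq47AxialChi (shiftN shiftN_zero shiftN_succ rowProd rowProd_zero rowProd_succ rect)
open B10Eq27TorusAxialLog (transl rel holT axialT contourT transl_apply transl_add transl_add_e transl_zero holT_eq_holAt contourT_eq)
open B7Prop1Explicit (treeWord seg e e_apply)
open Summit.QuantumFields.YangMills.Theorems.Prop7AxialGaugeSup (revWord_eq_wordRev mul_inv_eq_conj_of_axial)
open Summit.QuantumFields.YangMills.Theorems.Prop7FlatHolonomy (holAt_walk_single_true)
open Summit.QuantumFields.YangMills.Theorems.Prop7AxialGaugeFace (holAt_faceWord_of_axial dist1_mul_inv_le_three walkEnd_treeWord_rel)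
open Summit.QuantumFields.YangMills.Theorems.FluctuationComparisonRegPrIntLS2BetaIterAxialGaugeOneLevel (natAbs_rel_emb_le noWrap_emb
  rel_emb_face rel_emb_shift_of_face)
open BlockAveragingEMLProp2 (emb_shift_eq_shiftN)
open Summit.QuantumFields.YangMills.Theorems.FluctuationComparisonRegPrIntLS2BetaOneStepMeanLetter (holAt_walk_replicate_false
  walkEnd_shiftN holAt_walk_axisRun_of_nonneg holAt_walk_axisRun_of_neg axialAvg_eq_rowProd axialAvg_mul_avgFun_inv)
open Summit.QuantumFields.YangMills.Theorems.FluctuationComparisonRegPrIntLS2BetaStaircaseSlotStokes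

/-! ## §1 The RELATIVE INTERIOR LETTER in sum currency -/

section Interior

variable {P : Params} {j : ℕ} {G : Type*} [GaugeGroup G]

/-- ★★ **THE RELATIVE INTERIOR LETTER, SUM CURRENCY** (the hypotheses of ✓`Prop7AxialGaugeSup.dist1_mul_inv_le_of_axial` MINUS `PlaqSmall`; its
algebra ✓`mul_inv_eq_conj_of_axial` by name): if `W` and the background `U₀` have the same comb holonomies from `y` at both endpoints of the
non-wrapping bond `b = ⟨x, μ⟩`, then `dist1(W_b·U₀,b⁻¹) ≤ Σ_{κ ≠ μ} Σ_{r < |(x−y)_κ|} (dist1 W(∂p_{κ,r}) + dist1 U₀(∂p_{κ,r}))` over ONE `W, U₀`-independent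
family of at most `|x − y|₁` plaquette slots `p_{κ,r} = (site κ r; μ, κ)` inside the box spanned by the comb (`site κ r = y + w`, `|w_ι| ≤ |(x−y)_ι|`).
Tree bonds: every slot set of the later axes is empty, `W_b = U₀,b` — the relative field is `1` EXACTLY on the comb.
[cite: Balaban1985RegularSpaces, Lemma 1 (1.25) p.79; Balaban1985Averaging, pp.24-25, (19)-(20) p.21] -/
theorem exists_sites_dist1_mul_inv_le_of_axial (y x : Site P j) (μ : Fin P.d) (hwrap : (rel y x μ + 1) * 2 ≤ (P.sitesPerDir j : ℤ)) :
    ∃ site : Fin P.d → ℕ → Site P j,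
      (∀ κ, κ ≠ μ → ∀ r < (rel y x κ).natAbs, ∃ w : Fin P.d → ℤ, site κ r = transl y w ∧ ∀ ι, (w ι).natAbs ≤ (rel y x ι).natAbs) ∧
      ∀ W U₀ : GaugeField P j G, axialT W y x = axialT U₀ y x → axialT W y (x.shift μ) = axialT U₀ y (x.shift μ) →
        dist1 (W ⟨x, μ⟩ * (U₀ ⟨x, μ⟩)⁻¹) ≤
          ∑ κ ∈ univ.erase μ, ∑ r ∈ range (rel y x κ).natAbs, (dist1 (rect W (site κ r) μ κ 1 1) + dist1 (rect U₀ (site κ r) μ κ 1 1)) := by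
  obtain ⟨site, hloc, hbd⟩ := exists_sites_combLoop_le (G := G) y (rel y x) μ
  refine ⟨site, hloc, fun W U₀ hax hax' => ?_⟩
  rw [mul_inv_eq_conj_of_axial W U₀ y x μ hwrap hax hax']
  have hconj : dist1 ((axialT U₀ y x)⁻¹ * (holT W y (contourT y ⟨x, μ⟩) * (holT U₀ y (contourT y ⟨x, μ⟩))⁻¹) * axialT U₀ y x) =
      dist1 (holT W y (contourT y ⟨x, μ⟩) * (holT U₀ y (contourT y ⟨x, μ⟩))⁻¹) := by
    have h := GaugeGroup.dist1_conj (holT W y (contourT y ⟨x, μ⟩) * (holT U₀ y (contourT y ⟨x, μ⟩))⁻¹) (axialT U₀ y x)⁻¹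
    rwa [inv_inv] at h
  rw [hconj]
  have hloop : ∀ X : GaugeField P j G, dist1 (holT X y (contourT y ⟨x, μ⟩)) ≤
      ∑ κ ∈ univ.erase μ, ∑ r ∈ range (rel y x κ).natAbs, dist1 (rect X (site κ r) μ κ 1 1) := fun X => by
    rw [holT_eq_holAt, contourT_eq, revWord_eq_wordRev]
    exact hbd X
  calc dist1 (holT W y (contourT y ⟨x, μ⟩) * (holT U₀ y (contourT y ⟨x, μ⟩))⁻¹)
      ≤ dist1 (holT W y (contourT y ⟨x, μ⟩)) + dist1 (holT U₀ y (contourT y ⟨x, μ⟩))⁻¹ := GaugeGroup.dist1_mul_le _ _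
    _ = dist1 (holT W y (contourT y ⟨x, μ⟩)) + dist1 (holT U₀ y (contourT y ⟨x, μ⟩)) := by rw [GaugeGroup.dist1_inv]
    _ ≤ _ := add_le_add (hloop W) (hloop U₀)
    _ = _ := by simp only [sum_add_distrib]

/-- ★★ **THE RELATIVE INTERIOR LETTER AT A BLOCK of the averaging tower** (height `j`, `(j+1)`-fold blocks, standing range): `W` in the comb axial gauge
RELATIVE TO THE BACKGROUND `U₀` from every block centre (the gauge of ✓`Prop7AxialGauge.exists_axialGauge`, one-level reading), bond `⟨x, μ⟩` with both
endpoints in the block of `y` ⟹ the sum-currency bound with slots inside the block (`|w_ι| ≤ |(x − emb y)_ι| ≤ (L−1)∕2`, ✓`natAbs_rel_emb_le`; no wrap by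
✓`noWrap_emb`). [cite: Balaban1985RegularSpaces, (1.19) p.79, Lemma 1 (1.25) p.79; Balaban1987RG1, (0.3) p.252] -/
theorem exists_sites_dist1_mul_inv_le_interior (hj : j + 1 ≤ P.m + P.K) {x : Site P j} {y : Site P (j + 1)} (hx : blockOf x = y)
    (μ : Fin P.d) (hblock : blockOf (x.shift μ) = y) :
    ∃ site : Fin P.d → ℕ → Site P j,
      (∀ κ, κ ≠ μ → ∀ r < (rel (emb y) x κ).natAbs, ∃ w : Fin P.d → ℤ, site κ r = transl (emb y) w ∧
          ∀ ι, (w ι).natAbs ≤ (rel (emb y) x ι).natAbs) ∧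
      ∀ W U₀ : GaugeField P j G, (∀ z : Site P j, axialT W (emb (blockOf z)) z = axialT U₀ (emb (blockOf z)) z) →
        dist1 (W ⟨x, μ⟩ * (U₀ ⟨x, μ⟩)⁻¹) ≤
          ∑ κ ∈ univ.erase μ, ∑ r ∈ range (rel (emb y) x κ).natAbs,
            (dist1 (rect W (site κ r) μ κ 1 1) + dist1 (rect U₀ (site κ r) μ κ 1 1)) := by
  obtain ⟨site, hloc, hbd⟩ := exists_sites_dist1_mul_inv_le_of_axial (G := G) (emb y) x μ (noWrap_emb hj hx μ)
  refine ⟨site, hloc, fun W U₀ hax => hbd W U₀ ?_ ?_⟩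
  · have h := hax x; rwa [hx] at h
  · have h := hax (x.shift μ); rwa [hblock] at h

end Interior

/-! ## §2 The face loop and the RELATIVE FACE LETTER in sum currency -/

section Face

variable {P : Params} {j : ℕ} {G : Type*} [GaugeGroup G]

/-- A backward run of `q` steps read from its end: `end + q e_a = start` and the holonomy is the inverse row from the end (also for `q = 0`). [cite: Balaban1987RG1, (0.3) p.252] -/
theorem holAt_walk_axisRun_neg_natCast (U : GaugeField P j G) (x : Site P j) (a : Fin P.d) (q : ℕ) :
    shiftN (walkEnd x (axisRun a (-(q : ℤ)))) a q = x ∧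
      holAt U (walk x (axisRun a (-(q : ℤ)))) = (rowProd U (walkEnd x (axisRun a (-(q : ℤ)))) a q)⁻¹ := by
  rcases Nat.eq_zero_or_pos q with hq | hq
  · subst hq
    simp [axisRun, walk, walkEnd, holAt_nil]
  · have hk : (-(q : ℤ)) < 0 := by omega
    have h := holAt_walk_axisRun_of_neg U x a hk
    rwa [Int.natAbs_neg, Int.natAbs_natCast] at h

/-- ★ **THE CLOSED FACE WORD SPLITS INTO TWO STAIRCASE LOOPS.**  For an offset `v` with `v_μ = p ≥ 0`, the next-centre offset `v′ = v` off the axis `μ` and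
`v′_μ = −q`, `p + q + 1 = N`: the face word `Γ_{y,y+v} ∪ [x, x+e_μ] ∪ (−Γ_{y′,x+e_μ}) ∪ (−spine)` (`y′ = y + N e_μ`, spine = the straight `N`-run) has
`dist1 ≤` (fan loop at the end `z` of the `μ`-segment over the LATER axes, row `1`) `+` (diagonal staircase loop from `y` over the EARLIER axes, row `N`) —
the `μ`-segments `p`, `1`, `q` of the two combs concatenate to the transported spine. [cite: Balaban1985RegularSpaces, (1.26) p.79; Balaban1987RG1, (0.4) p.253] -/
theorem dist1_faceLoop_le_fan_add_stair (U : GaugeField P j G) (y : Site P j) (v v' : Fin P.d → ℤ) (μ : Fin P.d) (p q N : ℕ)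
    (hN : p + q + 1 = N) (hvμ : v μ = p) (hv' : ∀ κ, v' κ = if κ = μ then -(q : ℤ) else v κ)
    {s t : List (Fin P.d)} (hst : (List.finRange P.d).reverse = s ++ μ :: t) (hμs : μ ∉ s) (hμt : μ ∉ t) :
    dist1 (holAt U (walk y (treeWord v ++ [(μ, true)] ++ wordRev (treeWord v') ++ List.replicate N (μ, false)))) ≤
      dist1 (holAt U (walk (shiftN (walkEnd y (stairRuns v s)) μ p) (stairRuns v t)) *
          rowProd U (walkEnd (shiftN (walkEnd y (stairRuns v s)) μ p) (stairRuns v t)) μ 1 *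
          (holAt U (walk (shiftN (shiftN (walkEnd y (stairRuns v s)) μ p) μ 1) (stairRuns v t)))⁻¹ *
          (rowProd U (shiftN (walkEnd y (stairRuns v s)) μ p) μ 1)⁻¹) +
      dist1 (holAt U (walk y (stairRuns v s)) * rowProd U (walkEnd y (stairRuns v s)) μ N *
          (holAt U (walk (shiftN y μ N) (stairRuns v s)))⁻¹ * (rowProd U y μ N)⁻¹) := by
  have hv's : ∀ a ∈ s, v' a = v a := fun a ha => by
    have hne : a ≠ μ := by rintro rfl; exact hμs ha
    rw [hv', if_neg hne]
  have hv't : ∀ a ∈ t, v' a = v a := fun a ha => by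
    have hne : a ≠ μ := by rintro rfl; exact hμt ha
    rw [hv', if_neg hne]
  have hv'μ : v' μ = -(q : ℤ) := by rw [hv', if_pos rfl]
  have h1 : treeWord v = (stairRuns v s ++ axisRun μ (p : ℤ)) ++ stairRuns v t := by
    rw [treeWord_eq_stairRuns, hst, T4Continuum.stairRuns_append, stairRuns, hvμ, List.append_assoc]
  have h2 : treeWord v' = (stairRuns v s ++ axisRun μ (-(q : ℤ))) ++ stairRuns v t := by
    rw [treeWord_eq_stairRuns, hst, T4Continuum.stairRuns_append, stairRuns, hv'μ, stairRuns_congr hv's, stairRuns_congr hv't,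
      List.append_assoc]
  -- names
  set yA := walkEnd y (stairRuns v s) with hyA
  set z := shiftN yA μ p with hz
  set C := stairRuns v t with hC
  -- comb 1 from `y`
  obtain ⟨hP, hPend⟩ := holAt_walk_axisRun_of_nonneg U yA μ (show (0 : ℤ) ≤ (p : ℤ) by positivity)
  rw [Int.natAbs_natCast] at hP hPend
  have hT1 : holAt U (walk y (treeWord v)) = holAt U (walk y (stairRuns v s)) * rowProd U yA μ p * holAt U (walk z C) := by
    rw [h1, walk_append, holAt_append, walk_append, holAt_append, walkEnd_append, ← hyA, hP, hPend, ← hz, mul_assoc]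
  have hT1end : walkEnd y (treeWord v) = walkEnd z C := by
    rw [h1, walkEnd_append, walkEnd_append, ← hyA, hPend]
  -- comb 2 from `y' = y + N e_μ`
  obtain ⟨hQend, hQ⟩ := holAt_walk_axisRun_neg_natCast U (shiftN yA μ N) μ q
  have hz' : walkEnd (shiftN yA μ N) (axisRun μ (-(q : ℤ))) = z.shift μ := by
    rw [walkEnd_axisRun, shiftN_eq_transl, ← transl_add, hz, ← shiftN_succ, shiftN_eq_transl]
    congr 1; funext ι
    simp only [Pi.add_apply]
    split_ifs <;> omega
  rw [hz'] at hQend hQ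
  have hT2 : holAt U (walk (shiftN y μ N) (treeWord v')) =
      holAt U (walk (shiftN y μ N) (stairRuns v s)) * (rowProd U (z.shift μ) μ q)⁻¹ * holAt U (walk ((z.shift μ)) C) := by
    rw [h2, walk_append, holAt_append, walk_append, holAt_append, walkEnd_append, walkEnd_shiftN, ← hyA, hQ, hz', mul_assoc]
  have hT2end : walkEnd (shiftN y μ N) (treeWord v') = walkEnd (z.shift μ) C := by
    rw [h2, walkEnd_append, walkEnd_append, walkEnd_shiftN, ← hyA, hz']
  -- the far end of the first comb plus one step is the end of the second comb
  have hend : walkEnd y (treeWord v ++ [(μ, true)]) = walkEnd (shiftN y μ N) (treeWord v') := by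
    rw [walkEnd_append, hT1end, hT2end, show z.shift μ = shiftN z μ 1 from rfl, walkEnd_shiftN z μ 1 C]; rfl
  -- assemble the holonomy of the face word
  have hhol : holAt U (walk y (treeWord v ++ [(μ, true)] ++ wordRev (treeWord v') ++ List.replicate N (μ, false))) =
      (holAt U (walk y (stairRuns v s)) * rowProd U yA μ p) *
          (holAt U (walk z C) * U ⟨walkEnd z C, μ⟩ * (holAt U (walk (z.shift μ) C))⁻¹ * (U ⟨z, μ⟩)⁻¹) *
          (holAt U (walk y (stairRuns v s)) * rowProd U yA μ p)⁻¹ *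
        (holAt U (walk y (stairRuns v s)) * (rowProd U yA μ p * U ⟨z, μ⟩ * rowProd U (z.shift μ) μ q) *
          (holAt U (walk (shiftN y μ N) (stairRuns v s)))⁻¹ * (rowProd U y μ N)⁻¹) := by
    rw [walk_append, holAt_append, walkEnd_append, walk_append, holAt_append, hend, holAt_walk_wordRev, walkEnd_walkEnd_wordRev,
      holAt_walk_replicate_false, walk_append, holAt_append, hT1end, holAt_walk_single_true, hT1, hT2]
    group
  have hrow : rowProd U yA μ p * U ⟨z, μ⟩ * rowProd U (z.shift μ) μ q = rowProd U yA μ N := by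
    rw [hz, ← rowProd_succ, ← shiftN_succ, ← rowProd_add, show p + 1 + q = N by omega]
  rw [hhol, hrow]
  refine (GaugeGroup.dist1_mul_le _ _).trans (add_le_add (le_of_eq ?_) le_rfl)
  have hr1 : ∀ x' : Site P j, rowProd U x' μ 1 = U ⟨x', μ⟩ := fun x' => by simp [rowProd]
  rw [GaugeGroup.dist1_conj, hr1, hr1, shiftN_one, hz]

/-- ★★ **THE FACE LOOP IN SUM CURRENCY WITH A PLAQUETTE-SLOT FAMILY**: for `v_μ = p`, `v′ = v` off `μ`, `v′_μ = −q`, `p + q + 1 = N`, there is a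
`U`-independent family `site κ r s` (`κ ≠ μ`, `r < |v_κ|`, `s ≤ N`; each `= y + w` with `|w_ι| ≤ |v_ι|` off the axis and `0 ≤ w_μ < N` — inside the union of
the block box and its spine translates) with, for EVERY configuration,
`dist1 𝒰_y(Γ_{y,x} ∪ [x,x+e_μ] ∪ (−Γ_{y′,x+e_μ}) ∪ (−spine)) ≤ Σ_{κ≠μ} Σ_{r<|v_κ|} Σ_{s<N+1} dist1 U(∂p(site κ r s; μ, κ))` — at most `(N+1)·|v|₁ ≤ L² − 1`-class
plaquettes («a sum of arcs of `O(L²)` plaquette holonomies», UV3-NODE §57.8 (R2)). [cite: Balaban1985RegularSpaces, (1.26) p.79; Balaban1985Averaging, (19)-(20) p.21] -/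
theorem exists_sites_faceLoop_le (y : Site P j) (v v' : Fin P.d → ℤ) (μ : Fin P.d) (p q N : ℕ) (hN : p + q + 1 = N) (hvμ : v μ = p)
    (hv' : ∀ κ, v' κ = if κ = μ then -(q : ℤ) else v κ) :
    ∃ site : Fin P.d → ℕ → ℕ → Site P j,
      (∀ κ, κ ≠ μ → ∀ r < (v κ).natAbs, ∀ s < N + 1, ∃ w : Fin P.d → ℤ, site κ r s = transl y w ∧
          (∀ ι, ι ≠ μ → (w ι).natAbs ≤ (v ι).natAbs) ∧ 0 ≤ w μ ∧ w μ < N) ∧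
      ∀ U : GaugeField P j G,
        dist1 (holAt U (walk y (treeWord v ++ [(μ, true)] ++ wordRev (treeWord v') ++ List.replicate N (μ, false)))) ≤
          ∑ κ ∈ univ.erase μ, ∑ r ∈ range (v κ).natAbs, ∑ s ∈ range (N + 1), dist1 (rect U (site κ r s) μ κ 1 1) := by
  classical
  obtain ⟨s, t, hst, hμs, hμt, hs, ht, hdis⟩ := exists_split_axes μ
  have hNpos : 0 < N := by omega
  set yA := walkEnd y (stairRuns v s) with hyA
  set z := shiftN yA μ p with hz
  obtain ⟨site₁, hloc₁, hbd₁⟩ := exists_sites_stairLoop_le (G := G) μ 1 v t ht hμt z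
  obtain ⟨site₂, hloc₂, hbd₂⟩ := exists_sites_stairLoop_le (G := G) μ N v s hs hμs y
  have hzw : z = transl y (fun ι => (if ι ∈ s then v ι else 0) + (if ι = μ then (p : ℤ) else 0)) := by
    rw [hz, hyA, walkEnd_stairRuns y v hs, shiftN_eq_transl, ← transl_add]; rfl
  refine ⟨fun κ r s' => if s' < N then (if κ ∈ s then shiftN (site₂ κ r) μ s' else y) else (if κ ∈ t then site₁ κ r else y),
    fun κ hκμ r hr s' hs' => ?_, fun U => ?_⟩
  · -- locality
    dsimp only
    by_cases hs'N : s' < N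
    · rw [if_pos hs'N]
      by_cases hκs : κ ∈ s
      · rw [if_pos hκs]
        obtain ⟨w, hw, hwb⟩ := hloc₂ κ hκs r hr
        rw [hw, shiftN_eq_transl, ← transl_add]
        have hwμ : w μ = 0 := by have h := hwb μ; rw [if_neg hμs] at h; omega
        refine ⟨_, rfl, fun ι hιμ => ?_, ?_, ?_⟩
        · have h := hwb ι
          simp only [Pi.add_apply, if_neg hιμ, add_zero]
          split_ifs at h with hιs
          · exact h
          · exact h.trans (Nat.zero_le _)
        · simp [hwμ]
        · simp [hwμ]; exact_mod_cast hs'N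
      · rw [if_neg hκs]
        exact ⟨0, (transl_zero y).symm, fun ι _ => by simp, by simp, by simp; exact_mod_cast hNpos⟩
    · rw [if_neg hs'N]
      by_cases hκt : κ ∈ t
      · rw [if_pos hκt]
        obtain ⟨w, hw, hwb⟩ := hloc₁ κ hκt r hr
        rw [hw, hzw, ← transl_add]
        have hwμ : w μ = 0 := by have h := hwb μ; rw [if_neg hμt] at h; omega
        refine ⟨_, rfl, fun ι hιμ => ?_, ?_, ?_⟩
        · have h := hwb ι
          by_cases hιt : ι ∈ t
          · have hιs : ι ∉ s := fun h' => hdis ι h' hιt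
            rw [if_pos hιt] at h
            simp only [Pi.add_apply, if_neg hιs, if_neg hιμ, zero_add]
            exact h
          · rw [if_neg hιt] at h
            have hw0 : w ι = 0 := by omega
            simp only [Pi.add_apply, if_neg hιμ, hw0, add_zero]
            split_ifs <;> simp
        · simp [hμs, hwμ]
        · simp [hμs, hwμ]; exact_mod_cast (show p < N by omega)
      · rw [if_neg hκt]
        exact ⟨0, (transl_zero y).symm, fun ι _ => by simp, by simp, by simp; exact_mod_cast hNpos⟩
  · -- the bound
    dsimp only
    refine (dist1_faceLoop_le_fan_add_stair U y v v' μ p q N hN hvμ hv' hst hμs hμt).trans ?_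
    rw [← hyA, ← hz]
    have hsub_t : t.toFinset ⊆ univ.erase μ := fun κ hκ =>
      mem_erase.mpr ⟨fun h => hμt (h ▸ List.mem_toFinset.mp hκ), mem_univ _⟩
    have hsub_s : s.toFinset ⊆ univ.erase μ := fun κ hκ =>
      mem_erase.mpr ⟨fun h => hμs (h ▸ List.mem_toFinset.mp hκ), mem_univ _⟩
    -- split off the last slot `s' = N` (the fan) from the first `N` slots (the spine staircase)
    simp only [sum_range_succ, sum_add_distrib, lt_irrefl, if_false]
    rw [add_comm]
    refine add_le_add ?_ ?_
    · -- the staircase over the earlier axes, row length N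
      refine (hbd₂ U).trans ?_
      refine le_trans (le_of_eq (sum_congr rfl fun κ hκ => sum_congr rfl fun r _ => sum_congr rfl fun s' hs' => ?_))
        (sum_le_sum_of_subset_of_nonneg hsub_s fun κ _ _ => sum_nonneg fun r _ => sum_nonneg fun s' _ => GaugeGroup.dist1_nonneg _)
      rw [if_pos (mem_range.mp hs'), if_pos (List.mem_toFinset.mp hκ)]
    · -- the fan at `z`, row length 1
      refine (hbd₁ U).trans ?_
      refine le_trans (le_of_eq (sum_congr rfl fun κ hκ => sum_congr rfl fun r _ => ?_))
        (sum_le_sum_of_subset_of_nonneg hsub_t fun κ _ _ => sum_nonneg fun r _ => GaugeGroup.dist1_nonneg _)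
      rw [sum_range_one, shiftN_zero, if_pos (List.mem_toFinset.mp hκ)]

/-- ★★ **THE RELATIVE FACE LETTER, SUM CURRENCY** (algebra ✓`Prop7AxialGaugeFace.holAt_faceWord_of_axial` + ✓`dist1_mul_inv_le_three` by name): `W` and `U₀`
with the same comb holonomies from the centre `cy` to `x` and from the next centre `cy′ = cy + N e_μ` to `x + e_μ` (face geometry `(x − cy)_μ = p`,
`(x + e_μ − cy′) = (x − cy)` off `μ`, `= −q` on `μ`, `p + q + 1 = N`) ⟹
`dist1(W_b·U₀,b⁻¹) ≤ Σ_{slots} (dist1 W(∂p) + dist1 U₀(∂p)) + dist1 (W(spine)·U₀(spine)⁻¹)` — the two face loops in sum currency and the SPINE QUOTIENT;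
the coarse transporters along the spine enter only through their quotient (conjugation invariance: «the coarse bond CANCELS», UV3-NODE §57.8 (R2)).
[cite: Balaban1985RegularSpaces, Lemma 1 (1.26) p.79; Balaban1985Averaging, (19)-(20) p.21; Balaban1987RG1, (0.4) p.253] -/
theorem exists_sites_dist1_mul_inv_le_face_of_axial (cy x : Site P j) (μ : Fin P.d) (p q N : ℕ) (hN : p + q + 1 = N)
    (hvμ : rel cy x μ = p) (hv' : ∀ κ, rel (shiftN cy μ N) (x.shift μ) κ = if κ = μ then -(q : ℤ) else rel cy x κ) :
    ∃ site : Fin P.d → ℕ → ℕ → Site P j,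
      (∀ κ, κ ≠ μ → ∀ r < (rel cy x κ).natAbs, ∀ s < N + 1, ∃ w : Fin P.d → ℤ, site κ r s = transl cy w ∧
          (∀ ι, ι ≠ μ → (w ι).natAbs ≤ (rel cy x ι).natAbs) ∧ 0 ≤ w μ ∧ w μ < N) ∧
      ∀ W U₀ : GaugeField P j G, axialT W cy x = axialT U₀ cy x →
        axialT W (shiftN cy μ N) (x.shift μ) = axialT U₀ (shiftN cy μ N) (x.shift μ) →
        dist1 (W ⟨x, μ⟩ * (U₀ ⟨x, μ⟩)⁻¹) ≤
          ∑ κ ∈ univ.erase μ, ∑ r ∈ range (rel cy x κ).natAbs, ∑ s ∈ range (N + 1),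
              (dist1 (rect W (site κ r s) μ κ 1 1) + dist1 (rect U₀ (site κ r s) μ κ 1 1)) +
            dist1 (rowProd W cy μ N * (rowProd U₀ cy μ N)⁻¹) := by
  obtain ⟨site, hloc, hbd⟩ := exists_sites_faceLoop_le (G := G) cy (rel cy x) (rel (shiftN cy μ N) (x.shift μ)) μ p q N hN hvμ hv'
  refine ⟨site, hloc, fun W U₀ hax hax' => ?_⟩
  set FW := treeWord (rel cy x) ++ [(μ, true)] ++ wordRev (treeWord (rel (shiftN cy μ N) (x.shift μ))) with hFW
  clear_value FW
  have hFWend : walkEnd cy FW = shiftN cy μ N := by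
    have key : ∀ w : List (Letter P.d), walkEnd (shiftN cy μ N) w = x.shift μ → walkEnd (x.shift μ) (wordRev w) = shiftN cy μ N :=
      fun w hw => by rw [← hw, walkEnd_walkEnd_wordRev]
    rw [hFW, walkEnd_append, walkEnd_append, walkEnd_treeWord_rel]
    exact key _ (walkEnd_treeWord_rel _ _)
  have hloopEq : ∀ X : GaugeField P j G, dist1 (rowProd X cy μ N * (holAt X (walk cy FW))⁻¹) =
      dist1 (holAt X (walk cy (FW ++ List.replicate N (μ, false)))) := fun X => by
    rw [walk_append, holAt_append, hFWend, holAt_walk_replicate_false, ← GaugeGroup.dist1_inv, mul_inv_rev, inv_inv]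
  have h3 := dist1_mul_inv_le_three (rowProd W cy μ N) (rowProd U₀ cy μ N)
    (holAt_faceWord_of_axial W U₀ cy (shiftN cy μ N) x μ hax hax') (holAt_faceWord_of_axial U₀ U₀ cy (shiftN cy μ N) x μ rfl rfl)
  rw [← hFW, hloopEq W, hloopEq U₀] at h3
  have hW := hbd W
  have hU := hbd U₀
  have hsplit : ∑ κ ∈ univ.erase μ, ∑ r ∈ range (rel cy x κ).natAbs, ∑ s ∈ range (N + 1),
      (dist1 (rect W (site κ r s) μ κ 1 1) + dist1 (rect U₀ (site κ r s) μ κ 1 1)) =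
      (∑ κ ∈ univ.erase μ, ∑ r ∈ range (rel cy x κ).natAbs, ∑ s ∈ range (N + 1), dist1 (rect W (site κ r s) μ κ 1 1)) +
        ∑ κ ∈ univ.erase μ, ∑ r ∈ range (rel cy x κ).natAbs, ∑ s ∈ range (N + 1), dist1 (rect U₀ (site κ r s) μ κ 1 1) := by
    simp only [sum_add_distrib]
  rw [hsplit]
  linarith

/-- The spine quotient IS the coarse correction when the background reproduces the (0.4) average along the spine: `U₀(c) = Ū_W(c)` ⟹
`dist1 (U_W(c)·U₀(c)⁻¹) = dist1 (corr ℰ W c)` (✓(b3) §6 `axialAvg_mul_avgFun_inv`). [cite: Balaban1987RG1, (0.4) p.253; Balaban1985Averaging, (10) p.19] -/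
theorem dist1_axialAvg_mul_inv_eq_corr (ℰ : LoopAverage G) (W U₀ : GaugeField P j G) (c : PBond P (j + 1))
    (havg : AveragingRT.axialAvg U₀ c = BlockAveraging.avgFun ℰ W c) :
    dist1 (AveragingRT.axialAvg W c * (AveragingRT.axialAvg U₀ c)⁻¹) = dist1 (BlockAveraging.corr ℰ W c) := by
  rw [havg, axialAvg_mul_avgFun_inv, GaugeGroup.dist1_inv]

/-- ★★★ **THE RELATIVE FACE LETTER AT A BLOCK FACE of the averaging tower** (height `j`, standing range, `x` on the `μ`-face of the block of `y`): `W` in the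
comb axial gauge relative to `U₀` from the centres `emb y` and `emb (y + e_μ)` ⟹ the sum-currency bound with `N = L` (`p = q = (L−1)∕2`), slots in the block
box and its spine translates, plus the spine quotient `dist1 (U_W⟨y,μ⟩·U₀⟨y,μ⟩⁻¹)` of the STRAIGHT coarse transporters (tree `AveragingRT.axialAvg`) — which is
`dist1 (corr ℰ W ⟨y,μ⟩)` once the background reproduces the average (`dist1_axialAvg_mul_inv_eq_corr`): no coarse-bond size enters.
Face geometry by name: ✓`rel_emb_face`, ✓`rel_emb_shift_of_face` (px10 (i)). [cite: Balaban1985RegularSpaces, Lemma 1 (1.26) p.79; Balaban1987RG1, (0.3)-(0.4) pp.252-253] -/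
theorem exists_sites_dist1_mul_inv_le_face (hj : j + 1 ≤ P.m + P.K) {x : Site P j} {y : Site P (j + 1)} (hx : blockOf x = y) {μ : Fin P.d}
    (hface : (x μ).val % P.L + 1 = P.L) :
    ∃ site : Fin P.d → ℕ → ℕ → Site P j,
      (∀ κ, κ ≠ μ → ∀ r < (rel (emb y) x κ).natAbs, ∀ s < P.L + 1, ∃ w : Fin P.d → ℤ, site κ r s = transl (emb y) w ∧
          (∀ ι, ι ≠ μ → (w ι).natAbs ≤ (rel (emb y) x ι).natAbs) ∧ 0 ≤ w μ ∧ w μ < P.L) ∧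
      ∀ W U₀ : GaugeField P j G, axialT W (emb y) x = axialT U₀ (emb y) x →
        axialT W (emb (y.shift μ)) (x.shift μ) = axialT U₀ (emb (y.shift μ)) (x.shift μ) →
        dist1 (W ⟨x, μ⟩ * (U₀ ⟨x, μ⟩)⁻¹) ≤
          ∑ κ ∈ univ.erase μ, ∑ r ∈ range (rel (emb y) x κ).natAbs, ∑ s ∈ range (P.L + 1),
              (dist1 (rect W (site κ r s) μ κ 1 1) + dist1 (rect U₀ (site κ r s) μ κ 1 1)) +
            dist1 (AveragingRT.axialAvg W ⟨y, μ⟩ * (AveragingRT.axialAvg U₀ ⟨y, μ⟩)⁻¹) := by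
  have hL := AveragingRT.two_mul_half_add_one P
  have hN : (P.L - 1) / 2 + (P.L - 1) / 2 + 1 = P.L := by omega
  have hvμ : rel (emb y) x μ = (((P.L - 1) / 2 : ℕ) : ℤ) := rel_emb_face hj hx hface
  have hv' : ∀ κ, rel (shiftN (emb y) μ P.L) (x.shift μ) κ = if κ = μ then -(((P.L - 1) / 2 : ℕ) : ℤ) else rel (emb y) x κ := by
    intro κ
    rw [← emb_shift_eq_shiftN, rel_emb_shift_of_face hj hx hface, Pi.sub_apply, Pi.add_apply, Pi.smul_apply, e_apply, smul_eq_mul]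
    by_cases hκ : κ = μ
    · subst hκ; rw [if_pos rfl, if_pos rfl, hvμ]; push_cast; omega
    · rw [if_neg hκ, if_neg hκ]; ring
  obtain ⟨site, hloc, hbd⟩ := exists_sites_dist1_mul_inv_le_face_of_axial (G := G) (emb y) x μ _ _ P.L hN hvμ hv'
  refine ⟨site, hloc, fun W U₀ hax hax' => ?_⟩
  rw [axialAvg_eq_rowProd, axialAvg_eq_rowProd]
  rw [emb_shift_eq_shiftN] at hax'
  exact hbd W U₀ hax hax'

end Face

end Summit.QuantumFields.YangMills.Theorems.FluctuationComparisonRegPrIntLS2BetaRelativeFieldLetter
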